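import Literature.Computability.Complexity.TVHardnessScan
import Literature.Computability.Complexity.ListFoldChecks
import HarnessLib

/-!
# The literal-membership bit of the pre-order Tseitin clauses, in polynomial time

Literature / complexity — fourth file of the `PSPACE`-hardness of Trevisan–Vadhan's `LTV`: from the
prefix code of a matrix `φ`, the auxiliary base `V`, a position `t`, a slot `s < 3`, a variable `k`
and a polarity `pol`, the bit `[(k, pol) ∈ (blockAt (toks φ) V t)[s]]` — the incidence bits
`y_{jk}(φ), z_{jk}(φ)` of Trevisan–Vadhan's instance description for the clause `j = 3t + s` of the
padded pre-order Tseitin CNF (`TVHardnessTokens.lean`: `gcl3_eq_blocks_toks`, `getElem_blocks`) —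
computed with the scanning bricks of `TVHardnessScan.lean`:

* `TVHard.zerosOf` (`1ᵐ ↦ 0ᵐ`);
* the query record accessors `qC … qP` (`⟨c, ⟨1^V, ⟨1ᵗ, ⟨1ˢ, ⟨1ᵏ, [pol]⟩⟩⟩⟩⟩`), the derived data
  `sufT`, `sufT1`, `gU`, `c1U`, `c2U`, the tests `eG`, `eC1`, `eC2`, `eX`;
* **`TVHard.blockBit`** with **`blockBit_apply`**: its value is the membership bit.

Everything is proved; no named fact is introduced (D-0026).

## References

* L. Trevisan, S. Vadhan, Comput. Complexity 16 (2007), §4, (4.2) and Lemma 4.1 (ii) [TrevisanVadhan2007].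
* S. Arora, B. Barak, CUP 2009, Lemma 6.11 (proof), §1.3 [AroraBarakCC2009].
-/

noncomputable section

namespace Literature.Computability.Complexity

namespace TVHard

open _root_.Computability Polynomial Brick Plumb PreTseitin TVChk

/-! ### Zeros -/

/-- The round appending one `0`. [folklore] -/
def zerosOp : List Bool → List Bool := List.cons false ∘ fstF

/-- **`1ᵐ ↦ 0ᵐ`** (a counted fold). [folklore] -/
def zerosOf : List Bool → List Bool :=
  sndPow 2 ∘ foldLoop zerosOp (clipF 1 fun _ => []) X ∘ fanoutFn (fun w => w) (fanoutFn lenBinF (fun _ => boolPair [] []))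

/-- Growth of the round. [folklore] -/
theorem length_zerosOp_le (w : List Bool) : (zerosOp w).length ≤ (fstF w).length + (sndF w).length + 1 := by
  show (false :: fstF w).length ≤ _
  rw [List.length_cons]; omega

/-- `zerosOf ∈ FP`. [folklore] -/
theorem zerosOf_mem_FP : zerosOf ∈ FP :=
  comp_mem_FP (sndPow_mem_FP 2) (comp_mem_FP (foldLoop_clipF_mem_FP 1 (comp_mem_FP (cons_mem_FP false) fstF_mem_FP)
    length_zerosOp_le (const_mem_FP _) _)
    (fanoutFn_mem_FP (PolyTimeComputable.id _) (fanoutFn_mem_FP lenBinF_mem_FP (const_mem_FP _))))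

/-- The model of the zeros fold. [folklore] -/
theorem zeros_foldAcc (x : List Bool) (f : List Bool → List Bool) : ∀ (i k : ℕ) (acc : List Bool),
    foldAcc zerosOp f x i k acc = List.replicate k false ++ acc
  | i, 0, acc => rfl
  | i, k + 1, acc => by
    rw [foldAcc_succ, zeros_foldAcc x f (i + 1) k, zerosOp, Function.comp_apply, fstF_boolPair, List.replicate_succ', List.append_assoc]; rfl

/-- **Value of `zerosOf`.** [folklore] -/
theorem zerosOf_apply (w : List Bool) : zerosOf w = List.replicate w.length false := by
  have hinit : (fanoutFn (fun w => w) (fanoutFn lenBinF (fun _ => boolPair [] []))) w =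
      boolPair w (boolPair (encodeNat w.length) (boolPair (ones 0) [])) := by simp [ones]
  have hk : w.length ≤ (X : Polynomial ℕ).eval w.length := by simp
  rw [zerosOf, Function.comp_apply, Function.comp_apply, hinit, foldLoop_apply _ _ hk, sndPow_succ_boolPair, sndPow_succ_boolPair,
    sndPow_zero_boolPair, foldAcc_clipF (fun j _ _ => by simp), zeros_foldAcc, List.append_nil]

/-! ### The query record -/

/-- `c`, the matrix code. [folklore] -/
def qC : List Bool → List Bool := fstF
/-- `1^V`. [folklore] -/
def qV : List Bool → List Bool := fstF ∘ sndF
/-- `1ᵗ`. [folklore] -/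
def qT : List Bool → List Bool := fstF ∘ sndF ∘ sndF
/-- `1ˢ`. [folklore] -/
def qSl : List Bool → List Bool := fstF ∘ sndF ∘ sndF ∘ sndF
/-- `1ᵏ`. [folklore] -/
def qK : List Bool → List Bool := fstF ∘ sndF ∘ sndF ∘ sndF ∘ sndF
/-- `[pol]`. [folklore] -/
def qP : List Bool → List Bool := sndF ∘ sndF ∘ sndF ∘ sndF ∘ sndF

/-- The query record. [folklore] -/
def qRec (c : List Bool) (V t s k : ℕ) (pol : Bool) : List Bool :=
  boolPair c (boolPair (ones V) (boolPair (ones t) (boolPair (ones s) (boolPair (ones k) [pol]))))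

/-- Values of the accessors. [folklore] -/
theorem q_apply (c : List Bool) (V t s k : ℕ) (pol : Bool) :
    qC (qRec c V t s k pol) = c ∧ qV (qRec c V t s k pol) = ones V ∧ qT (qRec c V t s k pol) = ones t ∧
    qSl (qRec c V t s k pol) = ones s ∧ qK (qRec c V t s k pol) = ones k ∧ qP (qRec c V t s k pol) = [pol] := by
  simp [qC, qV, qT, qSl, qK, qP, qRec]

/-- The accessors are in `FP`. [folklore] -/
theorem q_mem_FP : qC ∈ FP ∧ qV ∈ FP ∧ qT ∈ FP ∧ qSl ∈ FP ∧ qK ∈ FP ∧ qP ∈ FP := by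
  refine ⟨fstF_mem_FP, comp_mem_FP fstF_mem_FP sndF_mem_FP, comp_mem_FP fstF_mem_FP (comp_mem_FP sndF_mem_FP sndF_mem_FP),
    comp_mem_FP fstF_mem_FP (comp_mem_FP sndF_mem_FP (comp_mem_FP sndF_mem_FP sndF_mem_FP)),
    comp_mem_FP fstF_mem_FP (comp_mem_FP sndF_mem_FP (comp_mem_FP sndF_mem_FP (comp_mem_FP sndF_mem_FP sndF_mem_FP))),
    comp_mem_FP sndF_mem_FP (comp_mem_FP sndF_mem_FP (comp_mem_FP sndF_mem_FP (comp_mem_FP sndF_mem_FP sndF_mem_FP)))⟩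

/-! ### Derived data -/

/-- The suffix from token `t`. [folklore] -/
def sufT : List Bool → List Bool := suffixF ∘ fanoutFn qC qT
/-- The suffix from token `t + 1`. [folklore] -/
def sufT1 : List Bool → List Bool := suffixF ∘ fanoutFn qC (List.cons true ∘ qT)
/-- `1^{V + t}` (the node's auxiliary). [folklore] -/
def gU : List Bool → List Bool := appF ∘ fanoutFn qV qT
/-- `1^{V + t + 1}` (first child). [folklore] -/
def c1U : List Bool → List Bool := List.cons true ∘ gU
/-- `1^{V + t + 1 + span}` (second child). [folklore] -/
def c2U : List Bool → List Bool := appF ∘ fanoutFn c1U (spanLenF ∘ sufT1)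
/-- `[k = g]`. [folklore] -/
def eG : List Bool → List Bool := eqPairFn ∘ fanoutFn gU qK
/-- `[k = c₁]`. [folklore] -/
def eC1 : List Bool → List Bool := eqPairFn ∘ fanoutFn c1U qK
/-- `[k = c₂]`. [folklore] -/
def eC2 : List Bool → List Bool := eqPairFn ∘ fanoutFn c2U qK
/-- `[k = x]` (the variable of a leading variable token, compared in binary). [folklore] -/
def eX : List Bool → List Bool := eqPairFn ∘ fanoutFn (payload1 ∘ sufT) (lenBinF ∘ qK)
/-- `[slot = 0]`. [folklore] -/
def sl0 : List Bool → List Bool := isNilFn ∘ qSl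
/-- `[slot = 1]`. [folklore] -/
def sl1 : List Bool → List Bool := eqPairFn ∘ fanoutFn qSl (fun _ => ones 1)
/-- The constant's bit, as a test. [folklore] -/
def cB : List Bool → List Bool := constBitT ∘ sufT

/-- These are in `FP`. [folklore] -/
theorem derived_mem_FP : sufT ∈ FP ∧ sufT1 ∈ FP ∧ gU ∈ FP ∧ c1U ∈ FP ∧ c2U ∈ FP ∧ eG ∈ FP ∧ eC1 ∈ FP ∧ eC2 ∈ FP ∧ eX ∈ FP ∧
    sl0 ∈ FP ∧ sl1 ∈ FP ∧ cB ∈ FP := by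
  obtain ⟨hC, hV, hT, hS, hK, -⟩ := q_mem_FP
  have hsuf : sufT ∈ FP := comp_mem_FP suffixF_mem_FP (fanoutFn_mem_FP hC hT)
  have hsuf1 : sufT1 ∈ FP := comp_mem_FP suffixF_mem_FP (fanoutFn_mem_FP hC (comp_mem_FP (cons_mem_FP true) hT))
  have hg : gU ∈ FP := comp_mem_FP appF_mem_FP (fanoutFn_mem_FP hV hT)
  have hc1 : c1U ∈ FP := comp_mem_FP (cons_mem_FP true) hg
  have hc2 : c2U ∈ FP := comp_mem_FP appF_mem_FP (fanoutFn_mem_FP hc1 (comp_mem_FP spanLenF_mem_FP hsuf1))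
  exact ⟨hsuf, hsuf1, hg, hc1, hc2, comp_mem_FP eqPairFn_mem_FP (fanoutFn_mem_FP hg hK), comp_mem_FP eqPairFn_mem_FP (fanoutFn_mem_FP hc1 hK),
    comp_mem_FP eqPairFn_mem_FP (fanoutFn_mem_FP hc2 hK),
    comp_mem_FP eqPairFn_mem_FP (fanoutFn_mem_FP (comp_mem_FP payload1_mem_FP hsuf) (comp_mem_FP lenBinF_mem_FP hK)),
    comp_mem_FP isNilFn_mem_FP hS, comp_mem_FP eqPairFn_mem_FP (fanoutFn_mem_FP hS (const_mem_FP _)), comp_mem_FP kindT_mem_FP.2.2.2.2 hsuf⟩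

/-- `ones` is injective. [folklore] -/
theorem ones_inj {a b : ℕ} : ones a = ones b ↔ a = b :=
  ⟨fun h => by have := congrArg List.length h; simpa [ones] using this, fun h => by rw [h]⟩

/-- Comparing unary numerals. [folklore] -/
theorem decide_ones_eq (a b : ℕ) : [decide (ones a = ones b)] = [decide (b = a)] := by
  congr 1; exact (Bool.decide_congr ones_inj).trans (Bool.decide_congr eq_comm)

/-- Comparing unary numerals, the other way. [folklore] -/
theorem decide_ones_eq' (a b : ℕ) : [decide (ones a = ones b)] = [decide (a = b)] := by
  congr 1; exact Bool.decide_congr ones_inj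

/-- Comparing binary numerals. [folklore] -/
theorem decide_encodeNat_eq (a b : ℕ) : [decide (encodeNat a = encodeNat b)] = [decide (b = a)] := by
  congr 1; exact (Bool.decide_congr Brick.encodeNat_inj).trans (Bool.decide_congr eq_comm)

section Values

variable (L L' : List PreTseitin.Tok) (tk : PreTseitin.Tok) {V t s k : ℕ} {pol : Bool}

/-- Values of the derived data on a genuine query (`L ⇂ t = tk :: L'`). [folklore] -/
theorem derived_apply (hL : L.drop t = tk :: L') (s k : ℕ) (pol : Bool) :
    sufT (qRec (tcode L) V t s k pol) = tcode (tk :: L') ∧ sufT1 (qRec (tcode L) V t s k pol) = tcode L' ∧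
    gU (qRec (tcode L) V t s k pol) = ones (V + t) ∧ c1U (qRec (tcode L) V t s k pol) = ones (V + t + 1) ∧
    c2U (qRec (tcode L) V t s k pol) = ones (V + t + 1 + spanLen L') := by
  obtain ⟨hC, hV, hT, -, -, -⟩ := q_apply (tcode L) V t s k pol
  have ht : t < L.length := by
    by_contra h
    rw [List.drop_eq_nil_of_le (not_lt.1 h)] at hL
    simp at hL
  have hlen := length_le_length_tcode L
  have hsuf : sufT (qRec (tcode L) V t s k pol) = tcode (tk :: L') := by
    rw [sufT, Function.comp_apply, fanoutFn_apply, hC, hT, suffixF_apply L (by omega), hL]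
  have hsuf1 : sufT1 (qRec (tcode L) V t s k pol) = tcode L' := by
    rw [sufT1, Function.comp_apply, fanoutFn_apply, hC, Function.comp_apply, hT, show true :: ones t = ones (t + 1) by simp [ones, List.replicate_succ],
      suffixF_apply L (by omega), ← List.drop_drop, hL]
    rfl
  have hg : gU (qRec (tcode L) V t s k pol) = ones (V + t) := by
    rw [gU, Function.comp_apply, fanoutFn_apply, hV, hT, appF_boolPair, ones, ones, ones, List.replicate_append_replicate]
  have hc1 : c1U (qRec (tcode L) V t s k pol) = ones (V + t + 1) := by
    rw [c1U, Function.comp_apply, hg]; simp [ones, List.replicate_succ]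
  refine ⟨hsuf, hsuf1, hg, hc1, ?_⟩
  rw [c2U, Function.comp_apply, fanoutFn_apply, hc1, Function.comp_apply, hsuf1, spanLenF_apply, appF_boolPair, ones, ones, ones,
    List.replicate_append_replicate]

/-- Values of the tests on a genuine query. [folklore] -/
theorem tests_apply (hL : L.drop t = tk :: L') (s k : ℕ) (pol : Bool) :
    eG (qRec (tcode L) V t s k pol) = [decide (k = V + t)] ∧ eC1 (qRec (tcode L) V t s k pol) = [decide (k = V + t + 1)] ∧
    eC2 (qRec (tcode L) V t s k pol) = [decide (k = V + t + 1 + spanLen L')] ∧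
    sl0 (qRec (tcode L) V t s k pol) = [decide (s = 0)] ∧ sl1 (qRec (tcode L) V t s k pol) = [decide (s = 1)] ∧
    (∀ n : ℕ, tk = .var n → eX (qRec (tcode L) V t s k pol) = [decide (k = n)]) ∧
    (∀ b : Bool, tk = .const b → cB (qRec (tcode L) V t s k pol) = [b]) := by
  obtain ⟨-, -, -, hS, hK, -⟩ := q_apply (tcode L) V t s k pol
  obtain ⟨hsuf, -, hg, hc1, hc2⟩ := derived_apply L L' tk hL s k pol
  refine ⟨?_, ?_, ?_, ?_, ?_, ?_, ?_⟩
  · rw [eG, Function.comp_apply, fanoutFn_apply, hg, hK, eqPairFn_boolPair, decide_ones_eq]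
  · rw [eC1, Function.comp_apply, fanoutFn_apply, hc1, hK, eqPairFn_boolPair, decide_ones_eq]
  · rw [eC2, Function.comp_apply, fanoutFn_apply, hc2, hK, eqPairFn_boolPair, decide_ones_eq]
  · rw [sl0, Function.comp_apply, hS, isNilFn]; simp [ones, List.replicate_eq_nil_iff]
  · rw [sl1, Function.comp_apply, fanoutFn_apply, hS, eqPairFn_boolPair, decide_ones_eq']
  · rintro n rfl
    have h1 : (payload1 ∘ sufT) (qRec (tcode L) V t s k pol) = encodeNat n := by rw [Function.comp_apply, hsuf, payload1_var]
    have h2 : (lenBinF ∘ qK) (qRec (tcode L) V t s k pol) = encodeNat k := by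
      rw [Function.comp_apply, hK, lenBinF_apply, ones, List.length_replicate]
    rw [eX, Function.comp_apply, fanoutFn_apply, h1, h2, eqPairFn_boolPair, decide_encodeNat_eq]
  · rintro b rfl
    rw [cB, Function.comp_apply, hsuf, constBitT_apply]

end Values

/-! ### The membership bit -/

/-- `[pol = 1]` as a one-bit test. [folklore] -/
def isP : List Bool → List Bool := eqPairFn ∘ fanoutFn qP (fun _ => [true])

/-- The variable node: slot `0` is `(¬g ∨ x)`, slots `1, 2` are `(g ∨ ¬x)`. [cite: AroraBarakCC2009, Lemma 6.11 (proof)] -/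
def varCase : List Bool → List Bool := iteFn isP (iteFn sl0 eX eG) (iteFn sl0 eG eX)
/-- The constant node: `(g)` if `b` else `(¬g)`. [cite: AroraBarakCC2009, Lemma 6.11 (proof)] -/
def constCase : List Bool → List Bool := iteFn isP (andFn cB eG) (andFn (notFn cB) eG)
/-- The negation node: slot `0` is `(¬g ∨ ¬c₁)`, slots `1, 2` are `(g ∨ c₁)`. [cite: AroraBarakCC2009, Lemma 6.11 (proof)] -/
def negCase : List Bool → List Bool := iteFn isP (iteFn sl0 (fun _ => [false]) (orFn eG eC1)) (iteFn sl0 (orFn eG eC1) (fun _ => [false]))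
/-- The conjunction node: `(¬g ∨ c₁)`, `(¬g ∨ c₂)`, `(g ∨ ¬c₁ ∨ ¬c₂)`. [cite: AroraBarakCC2009, Lemma 6.11 (proof)] -/
def conjCase : List Bool → List Bool := iteFn isP (iteFn sl0 eC1 (iteFn sl1 eC2 eG)) (iteFn sl0 eG (iteFn sl1 eG (orFn eC1 eC2)))
/-- The disjunction node: `(¬g ∨ c₁ ∨ c₂)`, `(g ∨ ¬c₁)`, `(g ∨ ¬c₂)`. [cite: AroraBarakCC2009, Lemma 6.11 (proof)] -/
def disjCase : List Bool → List Bool := iteFn isP (iteFn sl0 (orFn eC1 eC2) eG) (iteFn sl0 eG (iteFn sl1 eC1 eC2))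

/-- **The membership bit** `[(k, pol) ∈ (blockAt L V t)[s]]` on the query record. [cite: TrevisanVadhan2007, §4 (4.2)] [cite: AroraBarakCC2009, Lemma 6.11 (proof)] -/
def blockBit : List Bool → List Bool :=
  iteFn (isVarT ∘ sufT) varCase (iteFn (isConstT ∘ sufT) constCase (iteFn (isNegT ∘ sufT) negCase (iteFn (isConjT ∘ sufT) conjCase disjCase)))

/-- `blockBit ∈ FP`. [folklore] -/
theorem blockBit_mem_FP : blockBit ∈ FP := by
  obtain ⟨hsuf, -, -, -, -, hG, hC1, hC2, hX, hs0, hs1, hcb⟩ := derived_mem_FP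
  obtain ⟨hkv, hkc, hkn, hkj, -⟩ := kindT_mem_FP
  have hP : isP ∈ FP := comp_mem_FP eqPairFn_mem_FP (fanoutFn_mem_FP q_mem_FP.2.2.2.2.2 (const_mem_FP _))
  have hvar : varCase ∈ FP := iteFn_mem_FP hP (iteFn_mem_FP hs0 hX hG) (iteFn_mem_FP hs0 hG hX)
  have hconst : constCase ∈ FP := iteFn_mem_FP hP (andFn_mem_FP hcb hG) (andFn_mem_FP (notFn_mem_FP hcb) hG)
  have hneg : negCase ∈ FP := iteFn_mem_FP hP (iteFn_mem_FP hs0 (const_mem_FP _) (orFn_mem_FP hG hC1)) (iteFn_mem_FP hs0 (orFn_mem_FP hG hC1) (const_mem_FP _))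
  have hconj : conjCase ∈ FP := iteFn_mem_FP hP (iteFn_mem_FP hs0 hC1 (iteFn_mem_FP hs1 hC2 hG)) (iteFn_mem_FP hs0 hG (iteFn_mem_FP hs1 hG (orFn_mem_FP hC1 hC2)))
  have hdisj : disjCase ∈ FP := iteFn_mem_FP hP (iteFn_mem_FP hs0 (orFn_mem_FP hC1 hC2) hG) (iteFn_mem_FP hs0 hG (iteFn_mem_FP hs1 hC1 hC2))
  exact iteFn_mem_FP (comp_mem_FP hkv hsuf) hvar (iteFn_mem_FP (comp_mem_FP hkc hsuf) hconst (iteFn_mem_FP (comp_mem_FP hkn hsuf) hneg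
    (iteFn_mem_FP (comp_mem_FP hkj hsuf) hconj hdisj)))

/-- An unfolded `orFn` of two decisions. [folklore] -/
@[simp] theorem ite_true_decide (P Q : Prop) [Decidable P] [Decidable Q] :
    (if P then [true] else [decide Q]) = [decide P || decide Q] := by
  by_cases h : P <;> simp [h]

/-- One-bit tests. [folklore] -/
theorem oneBit_tests : OneBit isP ∧ OneBit sl0 ∧ OneBit sl1 ∧ OneBit eG ∧ OneBit eC1 ∧ OneBit eC2 ∧ OneBit eX :=
  ⟨oneBit_eqPairFn.comp _, oneBit_isNilFn.comp _, oneBit_eqPairFn.comp _, oneBit_eqPairFn.comp _, oneBit_eqPairFn.comp _,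
    oneBit_eqPairFn.comp _, oneBit_eqPairFn.comp _⟩

/-- **Value of the membership bit**: on the query `⟨tcode L, 1^V, 1ᵗ, 1ˢ, 1ᵏ, [pol]⟩` with
`L ⇂ t = tk :: L'` and `s < 3`, `blockBit` returns `[(k, pol) ∈ (blockAt L V t)[s]]`.
[cite: TrevisanVadhan2007, §4 (4.2)] [cite: AroraBarakCC2009, Lemma 6.11 (proof)] -/
theorem blockBit_apply (L L' : List PreTseitin.Tok) (tk : PreTseitin.Tok) {V t s : ℕ} (hL : L.drop t = tk :: L') (hs : s < 3)
    (k : ℕ) (pol : Bool) :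
    blockBit (qRec (tcode L) V t s k pol) = [decide ((k, pol) ∈ (blockAt L V t)[s]'(by rw [length_blockAt]; exact hs))] := by
  obtain ⟨hG, hC1, hC2, hs0, hs1, hX, hcb⟩ := tests_apply L L' tk (V := V) hL s k pol
  obtain ⟨hsuf, -, -, -, -⟩ := derived_apply L L' tk (V := V) hL s k pol
  obtain ⟨hkv, hkc, hkn, hkj⟩ := kindT_apply tk L'
  obtain ⟨oP, o0, o1, oG, oC1, oC2, oX⟩ := oneBit_tests
  have hP : isP (qRec (tcode L) V t s k pol) = [pol] := by
    rw [isP, Function.comp_apply, fanoutFn_apply, (q_apply (tcode L) V t s k pol).2.2.2.2.2, eqPairFn_boolPair]; cases pol <;> rfl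
  have hget : L[t]?.getD (.const false) = tk := by
    rw [← List.head?_drop, hL]; rfl
  have hspan : spanLen (L.drop (t + 1)) = spanLen L' := by rw [← List.drop_drop, hL]; rfl
  have hKV : (isVarT ∘ sufT) (qRec (tcode L) V t s k pol) = [(kindBits tk).1] := by rw [Function.comp_apply, hsuf, hkv]
  have hKC : (isConstT ∘ sufT) (qRec (tcode L) V t s k pol) = [(kindBits tk).2.1] := by rw [Function.comp_apply, hsuf, hkc]
  have hKN : (isNegT ∘ sufT) (qRec (tcode L) V t s k pol) = [(kindBits tk).2.2.1] := by rw [Function.comp_apply, hsuf, hkn]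
  have hKJ : (isConjT ∘ sufT) (qRec (tcode L) V t s k pol) = [(kindBits tk).2.2.2] := by rw [Function.comp_apply, hsuf, hkj]
  have hs3 : s = 0 ∨ s = 1 ∨ s = 2 := by omega
  -- reduce the right-hand side to the clause of the node, then evaluate the cascade
  cases tk with
  | var n =>
    have hX' := hX n rfl
    rw [blockBit, iteFn_apply_true hKV, varCase]
    rcases hs3 with rfl | rfl | rfl <;> cases pol <;>
      simp [iteFn_of_oneBit oP, iteFn_of_oneBit o0, hP, hs0, hX', hG, blockAt, hget, List.getD_eq_getElem?_getD]
  | const b =>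
    have hcb' := hcb b rfl
    rw [blockBit, iteFn_apply_false hKV, iteFn_apply_true hKC, constCase, iteFn_apply hP]
    cases pol
    · rw [if_neg Bool.false_ne_true, andFn_apply (notFn_apply hcb') hG]
      rcases hs3 with rfl | rfl | rfl <;> cases b <;> simp [blockAt, hget, List.getD_eq_getElem?_getD]
    · rw [if_pos rfl, andFn_apply hcb' hG]
      rcases hs3 with rfl | rfl | rfl <;> cases b <;> simp [blockAt, hget, List.getD_eq_getElem?_getD]
  | neg =>
    rw [blockBit, iteFn_apply_false hKV, iteFn_apply_false hKC, iteFn_apply_true hKN, negCase]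
    rcases hs3 with rfl | rfl | rfl <;> cases pol <;>
      simp [iteFn_of_oneBit oP, iteFn_of_oneBit o0, orFn, iteFn_of_oneBit oG, hP, hs0, hG, hC1, blockAt, hget, List.getD_eq_getElem?_getD]
  | conj =>
    rw [blockBit, iteFn_apply_false hKV, iteFn_apply_false hKC, iteFn_apply_false hKN, iteFn_apply_true hKJ, conjCase]
    rcases hs3 with rfl | rfl | rfl <;> cases pol <;>
      simp [iteFn_of_oneBit oP, iteFn_of_oneBit o0, iteFn_of_oneBit o1, orFn, iteFn_of_oneBit oC1, hP, hs0, hs1, hG, hC1, hC2, blockAt, hget, hspan, List.getD_eq_getElem?_getD]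
  | disj =>
    rw [blockBit, iteFn_apply_false hKV, iteFn_apply_false hKC, iteFn_apply_false hKN, iteFn_apply_false hKJ, disjCase]
    rcases hs3 with rfl | rfl | rfl <;> cases pol <;>
      simp [iteFn_of_oneBit oP, iteFn_of_oneBit o0, iteFn_of_oneBit o1, orFn, iteFn_of_oneBit oC1, hP, hs0, hs1, hG, hC1, hC2, blockAt, hget, hspan, List.getD_eq_getElem?_getD]

end TVHard

end Literature.Computability.Complexity

end
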